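import Summits.HubbardSuperconductivity.HubbardSuperconductivity.Theses.LogColdTorus
import Summits.HubbardSuperconductivity.HubbardSuperconductivity.Theorems.LogColdTorusUniformDescent
import Summits.HubbardSuperconductivity.HubbardSuperconductivity.Theorems.LogColdTorusLogColdToGroundStubGibbsDerivCovariance
import Summits.HubbardSuperconductivity.HubbardSuperconductivity.Theorems.LogColdTorusLogColdToGroundDescent
import HarnessLib.Audit

/-!
# Birth skeleton (BC3) — crux `LogColdToGround` (stmt-HubbardSuperconductivity-8808), route `LogColdTorus`

`Lines/birth.lean` of `Cruxes/LogColdToGround/` (planner, skeleton-register one-shot, 2026-08-17;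
RESHAPED by lead c2, 2026-08-17: the single open physics stub is now the FLOOR / persistence form
`stub_logColdPersistence`, the weakest statement with the same composition idea — see §v3 below;
the birth stub B `stub_pairOrderCovarianceBudget` implies it (`persistence_of_budget`, proved here
from the landed stub A + FTC) and is no longer registered).

## v3 (lead c2) — why the floor form.  Given the landed stub A, stub B says: the DROP
`Re ω_{κ₁ log L}(A_p) − Re ω_β(A_p)` is `≤ θ·c·L⁴` for every `β ≥ κ₁ log L`; lead c1 showed this is
the crux PLUS a Cauchy-in-κ uniformity (it bounds the drop from the log-cold VALUE, which may exceed
`c·L⁴` by far), i.e. strictly stronger than needed.  What the composition actually consumes is only a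
FLOOR: some `c' > 0`, `κ₁`, `L₁` with `c'·L⁴ ≤ Re ω_β(A_p)` for all `β ≥ κ₁ log L`, all `U` of the
window and all even `L ≥ L₁` — log-cold order PERSISTS to every colder temperature, eventually in `L`
and uniformly in `U` (no re-entrance between `T_L = 1/(κ₁ log L)` and `T = 0`).  This is verbatim the
hypothesis of the PROVED support `UniformDescent` (stmt-8809, `uniformDescent_proof`), which is the
whole glue: `LogColdToGround_of hF := ⟨c', hc', L₁, uniformDescent_proof … hF'⟩`.  Ordering of
strength: B ⇒ FLOOR ⇒ crux; FLOOR ⇏ B; crux ⇏ FLOOR (the crux lets the persistence threshold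
`β₀(U, L)` depend on `(U, L)` instead of `κ₁ log L`).  The floor stub is still the crux's physical
content (lead c1's toy `abstract_logColdDescent_false` violates it exactly as it violates the crux),
so the expected outcome of this line is `promote-stub` of the floor form = the route's kill-criterion
(b) pivot "restate `LogColdDWaveOrder` uniformly in `β ≥ κ₀ log L` and assemble through
`UniformDescent`".

The crux (rank 3, DESCENT): for all data `(δ, U₁, U₂, κ₀, c)`, if the `(N_L, S^z = 0)`-sector Gibbs
state of the pure torus Hubbard model `hubbardTorus 2 L 1 U` at the LOG-COLD inverse temperature
`β_L = κ log L` carries d-wave pair order `c·L⁴ ≤ Re ω^{sec}_{κ log L, L}(Δ_d†Δ_d)` for every `κ ≥ κ₀`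
(eventually in even `L`, the threshold `L₀` depending on `κ`, uniformly in `U ∈ (U₁,U₂)`), then the
tracial sector GROUND-STATE functional carries order `c'·L⁴` eventually in even `L` on the window.
The order of limits is the content: `L → ∞` at `β = κ log L` never reaches `β → ∞` at fixed `L`.

## The cut — the route's foreseen glued split `EnergyOrderAnticorrelation → MonotoneToGround →
LogColdToGround` (route file, TWO-LAYER PLAN), with the glue node `MonotoneToGround` PROVED here
(`budget_descent`) so that both registered stubs carry content, and with the anticorrelation stated
in its robust INTEGRATED form (see "why integrated" below).

* `stub_gibbsDerivCovariance : GibbsDerivCovariance` — FINITE-DIMENSIONAL THERMODYNAMICS (CLOSED: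
  landed by lead c1 wave 1 as `Summit.HubbardSuperconductivity.LogColdToGround.Thermo.stub_gibbsDerivCovariance`,
  `Theorems/LogColdTorusLogColdToGroundStubGibbsDerivCovariance.lean`, p146346; was: provable
  now, M-sized, Literature-grade; absent from the tree — grounder g15-8 on this item: "no
  covariance/derivative-in-β lemma for gibbsState found … a prover of the monotone variant must build
  d/dβ gibbsState = −Cov (finite-dimensional, ~150 lines)"): for a Hermitian matrix `H` and any
  observable `O`, `β ↦ ω_β(O) = tr(e^{-βH}O)/tr e^{-βH}` (`Matrix.gibbsState`) is differentiable on
  `ℝ` with `d/dβ ω_β(O) = -(ω_β(H·O) - ω_β(H)·ω_β(O)) = -Cov_β(H, O)` (quotient rule over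
  `d/dβ e^{-βH} = -H e^{-βH}`; the empty index type is the junk case `0 = 0`).
  Bratteli–Robinson II §5.3.1; Tasaki (2020) App. A; the source-direction twin is the tree's
  `hasDerivAt_re_gibbsState_source` (ApproximatingHamiltonianProofs).
* `stub_pairOrderCovarianceBudget : PairOrderCovarianceBudget` — THE PHYSICS (the crux's named
  sufficient mechanism "d/dβ ω_β(Δ_d†Δ_d) = -Cov_β(H, Δ_d†Δ_d) ≥ 0 below T_L: low-energy eigenstates
  carry more pair order", in budget form; L-sized, open): on a window carrying log-cold d-wave order
  with data `(δ,U₁,U₂,κ₀,c)` there are `κ₁ ≥ κ₀`, a budget fraction `θ < 1` and `L₁` such that for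
  every `U` of the window, every even `L ≥ L₁` and every `β ≥ κ₁ log L`, the energy–pair-order
  covariance of the sector Gibbs state, INTEGRATED from the log-cold inverse temperature `κ₁ log L`
  down to `β`, is at most `θ·c·L⁴`:  `∫_{κ₁ log L}^{β} Re Cov_s(H_p, (Δ_d†Δ_d)_p) ds ≤ θ·(c·L⁴)`.
  No re-entrance between `T_L = 1/(κ₁ log L)` and `T = 0`: cooling below the log-cold temperature
  never destroys more than the fraction `θ` of the pair order.  WHY INTEGRATED (not the pointwise sign
  `Cov_β ≤ 0 ∀ β`): at fixed `L` the sign of `Cov_β` as `β → ∞` is that of `ā(E₁) - ā(E₀)` for the two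
  lowest sector levels, and finite-size ground-state level crossings in `U` between two PAIRED
  quasi-degenerate states (different total momentum / `D₄` character) flip it on one side of every
  crossing — the pointwise statement is fragile for reasons irrelevant to the crux, while the budget
  is violated only by genuine re-entrance (a stripe/PDW sector ground state of `o(L⁴)` d-wave weight
  under a log-cold paired band — exactly the crux's why-might-fail).  `θ` is existential (crux-typing
  checklist (iv): no hand-picked threshold); the assembly needs only `θ < 1`.
* `LogColdToGround_of (hA : Registered.stub_gibbsDerivCovariance)
  (hB : Registered.stub_pairOrderCovarianceBudget) : LogColdToGround` — REAL PROOF (no sorry of its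
  own; ~25 lines + the proved glue `budget_descent`, ~30 lines): take `κ₁, θ, L₁` from `hB` and the
  log-cold order at `κ = κ₁` from the hypothesis (`L ≥ L₀(κ₁)`); by `hA` the real function
  `β ↦ Re ω_β((Δ†Δ)_p)` has the continuous derivative `-Re Cov_β`, so by the fundamental theorem of
  calculus `Re ω_β = Re ω_{κ₁ log L} - ∫ Re Cov ≥ c·L⁴ - θ·c·L⁴` for ALL `β ≥ κ₁ log L`; the
  zero-temperature limit of the Gibbs state of the Hermitian sector Hamiltonian
  (`le_re_groundStateFunctional_of_forall_ge`, from the PROVED support `UniformDescent`'s file) gives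
  `(1-θ)c·L⁴ ≤ Re ω₀^{sec}(Δ†Δ)`: `c' = (1-θ)c`, threshold `max L₀(κ₁) L₁`.

Disproof used: the crux directory has no `Disproof.lean` and no `Negative/` lemma (`ledger crux ls`:
no workfiles, 2026-08-17); no entry of `ledger negatives --problem HubbardSuperconductivity` has the
shape of either stub (stub A is pure matrix analysis; stub B is conditional on the log-cold order
hypothesis of THIS crux and bounds an integrated covariance — neither restates the crux, the summit,
or a refuted statement).
-/

noncomputable section

namespace Summit.HubbardSuperconductivity.HubbardSuperconductivity.Cruxes.LogColdToGround.Birth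

open scoped BigOperators Topology Manifold Classical MeasureTheory ProbabilityTheory Matrix InnerProductSpace ComplexConjugate ContinuousMap
open Filter Set Function TopologicalSpace MeasureTheory
open Literature.Hubbard
open Summit.HubbardSuperconductivity.HubbardSuperconductivity.Theses.LogColdTorus

set_option linter.dupNamespace false
set_option linter.unusedVariables false

/-! ## Registered stub (explicit signature: a Theorems-side stub file restates exactly this text) -/

/-- **Registered stub F — `LogColdPersistence`** (THE PHYSICS; open, load-bearing; the floor form
of the birth line's stub B).  For all data `(δ, U₁, U₂, κ₀, c)` with `0 < U₁ < U₂`, `0 < κ₀`, `0 < c`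
carrying LOG-COLD d-WAVE ORDER (the hypothesis is verbatim the antecedent of the crux
`Theses.LogColdTorus.LogColdToGround`: for every `κ ≥ κ₀`, eventually in even `L` and uniformly in
`U ∈ (U₁,U₂)`, `c·L⁴ ≤ Re ω^{sec}_{κ log L}(Δ_d†Δ_d)`), there are `c' > 0`, `κ₁` and `L₁` such that
for all `U ∈ (U₁,U₂)`, all even `L ≥ L₁` and ALL `β ≥ κ₁ log L`, the `(N_L, S^z=0)`-sector Gibbs
state of `hubbardTorus 2 L 1 U` (sector-compressed `H_p = H.toBlock p p`,
`A_p = (Δ_d†Δ_d).toBlock p p`, `Δ_d = pairField dWaveFormFactor L`) still carries d-wave pair order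
`c'·L⁴ ≤ Re ω_β(A_p)`: log-cold order persists to every colder temperature with an `L`-uniform
threshold — no re-entrance between `T_L = 1/(κ₁ log L)` and `T = 0`.  This is verbatim the
hypothesis of the route's PROVED support `UniformDescent` (stmt-HubbardSuperconductivity-8809). -/
theorem stub_logColdPersistence : ∀ (δ U₁ U₂ κ₀ c : ℝ), 0 < U₁ → U₁ < U₂ → 0 < κ₀ → 0 < c →
    (∀ κ : ℝ, κ₀ ≤ κ → ∃ L₀ : ℕ, ∀ U ∈ Set.Ioo U₁ U₂, ∀ (L : ℕ) [NeZero L], L₀ ≤ L → Even L → let p : Finset (Literature.MathematicalPhysics.QuantumLattice.Orb (Literature.MathematicalPhysics.QuantumLattice.FermionTorus 2 L)) → Prop := fun s => s.card = 2 * ⌊(1 - δ) * (L : ℝ) ^ 2 / 2⌋₊ ∧ 2 * (s.filter fun i => (ofLex i).2 = 0).card = 2 * ⌊(1 - δ) * (L : ℝ) ^ 2 / 2⌋₊; c * (L : ℝ) ^ 4 ≤ (Matrix.gibbsState (κ * Real.log L) ((Literature.MathematicalPhysics.QuantumLattice.hubbardTorus 2 L 1 U).toBlock p p) (((Literature.MathematicalPhysics.QuantumLattice.pairField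 Literature.MathematicalPhysics.QuantumLattice.dWaveFormFactor L)ᴴ * Literature.MathematicalPhysics.QuantumLattice.pairField Literature.MathematicalPhysics.QuantumLattice.dWaveFormFactor L).toBlock p p)).re) →
    ∃ c' : ℝ, 0 < c' ∧ ∃ κ₁ : ℝ, ∃ L₁ : ℕ, ∀ U ∈ Set.Ioo U₁ U₂, ∀ (L : ℕ) [NeZero L],
      L₁ ≤ L → Even L → ∀ β : ℝ, κ₁ * Real.log L ≤ β → let p : Finset (Literature.MathematicalPhysics.QuantumLattice.Orb (Literature.MathematicalPhysics.QuantumLattice.FermionTorus 2 L)) → Prop := fun s => s.card = 2 * ⌊(1 - δ) * (L : ℝ) ^ 2 / 2⌋₊ ∧ 2 * (s.filter fun i => (ofLex i).2 = 0).card = 2 * ⌊(1 - δ) * (L : ℝ) ^ 2 / 2⌋₊;  c' * (L : ℝ) ^ 4 ≤ (Matrix.gibbsState β ((Literature.MathematicalPhysics.QuantumLattice.hubbardTorus 2 L 1 U).toBlock p p) (((Literature.MathematicalPhysics.QuantumLattice.pairField Literature.MathematicalPhysics.QuantumLattice.dWaveFormFactor L)ᴴ * Literature.MathematicalPhysics.QuantumLattice.pairField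 Literature.MathematicalPhysics.QuantumLattice.dWaveFormFactor L).toBlock p p)).re := by
  sorry

/-! ## Registered text of the stub (the audit admits exactly this name as hypothesis) -/

namespace Registered

/-- Registered text of `stub_logColdPersistence`. -/
abbrev stub_logColdPersistence : Prop := ∀ (δ U₁ U₂ κ₀ c : ℝ), 0 < U₁ → U₁ < U₂ → 0 < κ₀ → 0 < c →
    (∀ κ : ℝ, κ₀ ≤ κ → ∃ L₀ : ℕ, ∀ U ∈ Set.Ioo U₁ U₂, ∀ (L : ℕ) [NeZero L], L₀ ≤ L → Even L → let p : Finset (Literature.MathematicalPhysics.QuantumLattice.Orb (Literature.MathematicalPhysics.QuantumLattice.FermionTorus 2 L)) → Prop := fun s => s.card = 2 * ⌊(1 - δ) * (L : ℝ) ^ 2 / 2⌋₊ ∧ 2 * (s.filter fun i => (ofLex i).2 = 0).card = 2 * ⌊(1 - δ) * (L : ℝ) ^ 2 / 2⌋₊; c * (L : ℝ) ^ 4 ≤ (Matrix.gibbsState (κ * Real.log L) ((Literature.MathematicalPhysics.QuantumLattice.hubbardTorus 2 L 1 U).toBlock p p) (((Literature.MathematicalPhysics.QuantumLattice.pairField Literature.MathematicalPhysics.QuantumLattice.dWaveFormFactor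 L)ᴴ * Literature.MathematicalPhysics.QuantumLattice.pairField Literature.MathematicalPhysics.QuantumLattice.dWaveFormFactor L).toBlock p p)).re) →
    ∃ c' : ℝ, 0 < c' ∧ ∃ κ₁ : ℝ, ∃ L₁ : ℕ, ∀ U ∈ Set.Ioo U₁ U₂, ∀ (L : ℕ) [NeZero L],
      L₁ ≤ L → Even L → ∀ β : ℝ, κ₁ * Real.log L ≤ β → let p : Finset (Literature.MathematicalPhysics.QuantumLattice.Orb (Literature.MathematicalPhysics.QuantumLattice.FermionTorus 2 L)) → Prop := fun s => s.card = 2 * ⌊(1 - δ) * (L : ℝ) ^ 2 / 2⌋₊ ∧ 2 * (s.filter fun i => (ofLex i).2 = 0).card = 2 * ⌊(1 - δ) * (L : ℝ) ^ 2 / 2⌋₊;  c' * (L : ℝ) ^ 4 ≤ (Matrix.gibbsState β ((Literature.MathematicalPhysics.QuantumLattice.hubbardTorus 2 L 1 U).toBlock p p) (((Literature.MathematicalPhysics.QuantumLattice.pairField Literature.MathematicalPhysics.QuantumLattice.dWaveFormFactor L)ᴴ * Literature.MathematicalPhysics.QuantumLattice.pairField Literature.MathematicalPhysics.QuantumLattice.dWaveFormFactor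 L).toBlock p p)).re

/-- Text of the birth line's former stub B `stub_pairOrderCovarianceBudget` (lead c1; no longer
registered — kept so that `persistence_of_budget` certifies that the birth line embeds in v3). -/
abbrev stub_pairOrderCovarianceBudget : Prop := ∀ (δ U₁ U₂ κ₀ c : ℝ), 0 < U₁ → U₁ < U₂ → 0 < κ₀ → 0 < c →
    (∀ κ : ℝ, κ₀ ≤ κ → ∃ L₀ : ℕ, ∀ U ∈ Set.Ioo U₁ U₂, ∀ (L : ℕ) [NeZero L], L₀ ≤ L → Even L → let p : Finset (Literature.MathematicalPhysics.QuantumLattice.Orb (Literature.MathematicalPhysics.QuantumLattice.FermionTorus 2 L)) → Prop := fun s => s.card = 2 * ⌊(1 - δ) * (L : ℝ) ^ 2 / 2⌋₊ ∧ 2 * (s.filter fun i => (ofLex i).2 = 0).card = 2 * ⌊(1 - δ) * (L : ℝ) ^ 2 / 2⌋₊; c * (L : ℝ) ^ 4 ≤ (Matrix.gibbsState (κ * Real.log L) ((Literature.MathematicalPhysics.QuantumLattice.hubbardTorus 2 L 1 U).toBlock p p) (((Literature.MathematicalPhysics.QuantumLattice.pairField Literature.MathematicalPhysics.QuantumLattice.dWaveFormFactor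 L)ᴴ * Literature.MathematicalPhysics.QuantumLattice.pairField Literature.MathematicalPhysics.QuantumLattice.dWaveFormFactor L).toBlock p p)).re) →
    ∃ κ₁ : ℝ, κ₀ ≤ κ₁ ∧ ∃ θ : ℝ, θ < 1 ∧ ∃ L₁ : ℕ, ∀ U ∈ Set.Ioo U₁ U₂, ∀ (L : ℕ) [NeZero L],
      L₁ ≤ L → Even L → ∀ β : ℝ, κ₁ * Real.log L ≤ β → let p : Finset (Literature.MathematicalPhysics.QuantumLattice.Orb (Literature.MathematicalPhysics.QuantumLattice.FermionTorus 2 L)) → Prop := fun s => s.card = 2 * ⌊(1 - δ) * (L : ℝ) ^ 2 / 2⌋₊ ∧ 2 * (s.filter fun i => (ofLex i).2 = 0).card = 2 * ⌊(1 - δ) * (L : ℝ) ^ 2 / 2⌋₊; ∫ s in (κ₁ * Real.log L)..β, (Matrix.gibbsState s ((Literature.MathematicalPhysics.QuantumLattice.hubbardTorus 2 L 1 U).toBlock p p) (((Literature.MathematicalPhysics.QuantumLattice.hubbardTorus 2 L 1 U).toBlock p p) * (((Literature.MathematicalPhysics.QuantumLattice.pairField Literature.MathematicalPhysics.QuantumLattice.dWaveFormFactor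 L)ᴴ * Literature.MathematicalPhysics.QuantumLattice.pairField Literature.MathematicalPhysics.QuantumLattice.dWaveFormFactor L).toBlock p p)) - Matrix.gibbsState s ((Literature.MathematicalPhysics.QuantumLattice.hubbardTorus 2 L 1 U).toBlock p p) ((Literature.MathematicalPhysics.QuantumLattice.hubbardTorus 2 L 1 U).toBlock p p) * Matrix.gibbsState s ((Literature.MathematicalPhysics.QuantumLattice.hubbardTorus 2 L 1 U).toBlock p p) (((Literature.MathematicalPhysics.QuantumLattice.pairField Literature.MathematicalPhysics.QuantumLattice.dWaveFormFactor L)ᴴ * Literature.MathematicalPhysics.QuantumLattice.pairField Literature.MathematicalPhysics.QuantumLattice.dWaveFormFactor L).toBlock p p)).re ≤ θ * (c * (L : ℝ) ^ 4)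

end Registered

/-! ## The birth line embeds: budget ⇒ persistence (stub A landed + FTC), kernel-checked -/

/-- **B ⇒ F.**  The covariance budget of the birth line (former stub B) implies the floor stub:
take the log-cold order at `κ = κ₁` (`L ≥ L₀(κ₁)`); by the landed derivative formula
`d/dβ ω_β(O) = -Cov_β(H, O)` (stub A, `Thermo.stub_gibbsDerivCovariance`) and the fundamental
theorem of calculus, `Re ω_β(A_p) = Re ω_{κ₁ log L}(A_p) - ∫ Re Cov ≥ c·L⁴ - θ·c·L⁴` for every
`β ≥ κ₁ log L`; so `c' = (1 - θ)c`, threshold `max L₀(κ₁) L₁`.  Bratteli–Robinson II §5.3.1. -/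
theorem persistence_of_budget (hB : Registered.stub_pairOrderCovarianceBudget) :
    Registered.stub_logColdPersistence := by
  intro δ U₁ U₂ κ₀ c hU₁ hU₁₂ hκ₀ hc hlog
  obtain ⟨κ₁, hκ₁, θ, hθ, L₁, hbud⟩ := hB δ U₁ U₂ κ₀ c hU₁ hU₁₂ hκ₀ hc hlog
  obtain ⟨L₀, hord⟩ := hlog κ₁ hκ₁
  refine ⟨(1 - θ) * c, mul_pos (sub_pos.mpr hθ) hc, κ₁, max L₀ L₁, ?_⟩
  intro U hU L _ hL hev β hβ p
  have hL₀ : L₀ ≤ L := le_of_max_le_left hL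
  have hL₁ : L₁ ≤ L := le_of_max_le_right hL
  have hH : (Literature.MathematicalPhysics.QuantumLattice.hubbardTorus 2 L 1 U).IsHermitian :=
    Literature.MathematicalPhysics.QuantumLattice.hubbardTorus_isHermitian
      (Literature.MathematicalPhysics.QuantumLattice.hamiltonian_isHermitian_and_commute_holds _) 1 U
  have hH' : ((Literature.MathematicalPhysics.QuantumLattice.hubbardTorus 2 L 1 U).toBlock p p).IsHermitian :=
    hH.submatrix _
  -- abbreviations
  set Hp := (Literature.MathematicalPhysics.QuantumLattice.hubbardTorus 2 L 1 U).toBlock p p with hHp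
  set Ap := (((Literature.MathematicalPhysics.QuantumLattice.pairField Literature.MathematicalPhysics.QuantumLattice.dWaveFormFactor L)ᴴ * Literature.MathematicalPhysics.QuantumLattice.pairField Literature.MathematicalPhysics.QuantumLattice.dWaveFormFactor L).toBlock p p) with hAp
  -- stub A (landed): every Gibbs expectation is differentiable in β with derivative -Cov
  have hderiv : ∀ (O : Matrix _ _ ℂ) (t : ℝ), HasDerivAt (fun s : ℝ => Matrix.gibbsState s Hp O)
      (-(Matrix.gibbsState t Hp (Hp * O) - Matrix.gibbsState t Hp Hp * Matrix.gibbsState t Hp O)) t :=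
    fun O t => Summit.HubbardSuperconductivity.LogColdToGround.Thermo.stub_gibbsDerivCovariance Hp O hH' t
  have hcont : ∀ O : Matrix _ _ ℂ, Continuous fun s : ℝ => Matrix.gibbsState s Hp O := fun O =>
    continuous_iff_continuousAt.mpr fun s => (hderiv O s).continuousAt
  have hcov_cont : Continuous fun s : ℝ =>
      (Matrix.gibbsState s Hp (Hp * Ap) - Matrix.gibbsState s Hp Hp * Matrix.gibbsState s Hp Ap).re :=
    Complex.continuous_re.comp ((hcont (Hp * Ap)).sub ((hcont Hp).mul (hcont Ap)))
  have hre : ∀ t : ℝ, HasDerivAt (fun s : ℝ => (Matrix.gibbsState s Hp Ap).re)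
      (-(Matrix.gibbsState t Hp (Hp * Ap) - Matrix.gibbsState t Hp Hp * Matrix.gibbsState t Hp Ap).re) t :=
    fun t => (Complex.reCLM.hasFDerivAt.comp_hasDerivAt t (hderiv Ap t)).congr_deriv (by simp)
  have hftc : ∫ s in (κ₁ * Real.log L)..β,
      -(Matrix.gibbsState s Hp (Hp * Ap) - Matrix.gibbsState s Hp Hp * Matrix.gibbsState s Hp Ap).re =
        (Matrix.gibbsState β Hp Ap).re - (Matrix.gibbsState (κ₁ * Real.log L) Hp Ap).re :=
    intervalIntegral.integral_eq_sub_of_hasDerivAt (f := fun s : ℝ => (Matrix.gibbsState s Hp Ap).re)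
      (fun x _ => hre x) (hcov_cont.neg.intervalIntegrable _ _)
  rw [intervalIntegral.integral_neg] at hftc
  have h1 := hbud U hU L hL₁ hev β hβ
  have h2 := hord U hU L hL₀ hev
  have e : (1 - θ) * c * (L : ℝ) ^ 4 = c * (L : ℝ) ^ 4 - θ * (c * (L : ℝ) ^ 4) := by ring
  rw [e]
  linarith

/-! ## The composition (kernel-checked, no sorry of its own) -/

/-- **Skeleton theorem (v3).**  The floor stub implies the crux `Theses.LogColdTorus.LogColdToGround`
BY NAME: persistence of the log-cold order to all `β ≥ κ₁ log L` (stub F) is exactly the hypothesis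
of the route's PROVED support `UniformDescent` (`uniformDescent_proof`: the sector-compressed
Hamiltonian is Hermitian, its Gibbs state tends to the tracial ground-state functional as `β → ∞`,
and the closed inequality passes to the limit), which yields ground-state order `c'·L⁴` on the same
window from the same threshold `L₁`. -/
theorem LogColdToGround_of (hF : Registered.stub_logColdPersistence) : LogColdToGround := by
  intro δ U₁ U₂ κ₀ c hU₁ hU₁₂ hκ₀ hc hlog
  obtain ⟨c', hc', κ₁, L₁, hper⟩ := hF δ U₁ U₂ κ₀ c hU₁ hU₁₂ hκ₀ hc hlog
  exact ⟨c', hc', L₁,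
    Summit.HubbardSuperconductivity.HubbardSuperconductivity.Theorems.LogColdTorus.uniformDescent_proof
      δ U₁ U₂ κ₁ c' L₁ hc' hper⟩

/-- The birth line (stubs A + B) still closes the crux: B ⇒ F ⇒ crux (an `example`, so that the
skeleton has exactly one theorem concluding the crux). -/
example (hB : Registered.stub_pairOrderCovarianceBudget) : LogColdToGround :=
  LogColdToGround_of (persistence_of_budget hB)

end Summit.HubbardSuperconductivity.HubbardSuperconductivity.Cruxes.LogColdToGround.Birth

end
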